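import Summits.ResolutionOfSingularities.ResolutionOfSingularities.Theorems.FrobeniusClosingPatchingRelPerfectConeDepthLineStep
import Summits.ResolutionOfSingularities.ResolutionOfSingularities.Theorems.FrobeniusClosingPatchingRelPerfectConeDepthPointFibre
import Summits.ResolutionOfSingularities.ResolutionOfSingularities.Theorems.FrobeniusClosingPatchingRelPerfectConeDepthSmoothConeClimb
import HarnessLib

/-!
# Crux `PatchingRelPerfect` (stmt-ResolutionOfSingularities-16161), chain W5.2 — rung «r-binary-disc-ℓ», CLIMBING THE LINE LADDER:
# the END in companion form, the induction on the line exponent, and the foot of the ladder on `Spec S`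

[OURS · L1 W5.2 · rung tool] Replaces the role of NO printed item; NOT a statement of the manuscript under review; fact-free,
any characteristic, any residue field.  AI-written (AI review is weaker than expert review).

* `LineState.companion_of_zero` / `LineState.companion`: every line-ladder state gives `I` an `𝔪`-primary companion `Q` with
  `Bl_{I·Q} Spec S` regular — strong induction on the exponent `b`, one rung = `LineState.step` (blow up the bad line), the END
  (`coneEndCompanion`) at `b = 0`.
* `LineState.initial`: THE FOOT — for `S` regular local with regular system of parameters `x₀, …, x₃`, `q = x₀² + b x₀x₁ + a x₁²` with
  `b² − 4a ∈ S×` and `I = (q) + 𝔪^{ℓ+2}`, the blowing up `X₁ = Bl_𝔪 Spec S` carries a line-ladder state with exponents `(0, ℓ)`: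
  `I𝒪_{X₁} = 𝓘_{E₁}² · (𝓗₁ ⊔ 𝓘_{E₁}^ℓ)`, bad line `Z₁ = P₁' ∩ P₂' ∩ E₁` (the strict transforms of `V(x₀)`, `V(x₁)` meeting the
  exceptional divisor), by THE POINT FIBRE THEOREM at the closed point of `Spec S`; the point `(φ x₂, e₀, e₁, e₃) ∈ D₊(x₂)` witnesses
  that the bad line is non-empty.

## References
* J. Kollár, *Lectures on Resolution of Singularities* (2007), 3.61, (3.111) Step 3. [Kollar2007]
* The Stacks Project, Tags 080A, 0804, 0BIQ. [StacksProject]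
* R. Hartshorne, *Algebraic Geometry*, II Prop. 5.1 (b). [Hartshorne1977]
-/

set_option linter.dupNamespace false

noncomputable section

open CategoryTheory CategoryTheory.Limits AlgebraicGeometry TopologicalSpace IsLocalRing
open Literature.AlgebraicGeometry.Resolution
open Scheme.IdealSheafData
open scoped Pointwise

namespace Summit.ResolutionOfSingularities.ResolutionOfSingularities.Theorems

universe u

namespace ConeDepth

/-! ## §1 The witness point of the new line on the chart `D₊(c₂)` -/

section PointPrime

variable {R : Type u} [CommRing R] [IsRegularLocalRing R] (c : Fin 4 → R)
  (hz : Ideal.span (Set.range c) = maximalIdeal R) (hd : (maximalIdeal R).spanFinrank = 4)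

/-- No free indices remain after killing `e₀, e₁, e₃` on the chart `2`. [folklore] -/
theorem isEmpty_pointKill : IsEmpty {j : Fin 4 // j ≠ (2 : Fin 4) ∧ j ∉ ({0, 1, 3} : Set (Fin 4))} :=
  ⟨fun ⟨j, hj2, hj⟩ => by
    fin_cases j
    all_goals simp at hj hj2⟩

include hz hd in
/-- **The ideal `(φ c₂, e₀, e₁, e₃)` of the chart `D₊(c₂)` is maximal**: the chart modulo it is the residue field.
[cite: StacksProject, Tag 0BIQ] -/
theorem isMaximal_pointIdeal : (chartStageIdeal c 2 (⊥ : Ideal R) ({0, 1, 3} : Set (Fin 4))).IsMaximal := by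
  have hsup : Ideal.span (Set.range c) ⊔ (⊥ : Ideal R) = maximalIdeal R := by rw [sup_bot_eq, hz]
  haveI : (Ideal.span (Set.range c) ⊔ (⊥ : Ideal R)).IsMaximal := by rw [hsup]; exact maximalIdeal.isMaximal R
  have hz' : Ideal.span (Set.range (Fin.append c (Fin.elim0 : Fin 0 → R))) = maximalIdeal R := by
    rw [Fin.append_elim0, (Fin.rightInverse_cast (Nat.add_zero 4)).surjective.range_comp]; exact hz
  have e1 := chartStageEquiv c 2 (⊥ : Ideal R) ({0, 1, 3} : Set (Fin 4)) (isQuasiRegular_centre c Fin.elim0 hz' hd) (by simp)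
  haveI := isEmpty_pointKill
  have e2 : MvPolynomial {j : Fin 4 // j ≠ (2 : Fin 4) ∧ j ∉ ({0, 1, 3} : Set (Fin 4))} (R ⧸ (Ideal.span (Set.range c) ⊔ (⊥ : Ideal R)))
      ≃+* R ⧸ (Ideal.span (Set.range c) ⊔ (⊥ : Ideal R)) :=
    (MvPolynomial.isEmptyAlgEquiv _ _).toRingEquiv
  letI : Field (R ⧸ (Ideal.span (Set.range c) ⊔ (⊥ : Ideal R))) := Ideal.Quotient.field _
  refine Ideal.Quotient.maximal_of_isField _ ?_
  exact MulEquiv.isField (Field.toIsField _) (e1.symm.trans e2).toMulEquiv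

include hz hd in
/-- The witness ideal lies over `𝔪`. [folklore] -/
theorem comap_pointIdeal :
    (chartStageIdeal c 2 (⊥ : Ideal R) ({0, 1, 3} : Set (Fin 4))).comap (chartBase c 2) = maximalIdeal R := by
  refine ((maximalIdeal.isMaximal R).eq_of_le ?_ ?_).symm
  · exact Ideal.comap_ne_top _ (isMaximal_pointIdeal c hz hd).ne_top
  · rw [← hz, Ideal.span_le]
    rintro _ ⟨j, rfl⟩
    rw [SetLike.mem_coe, Ideal.mem_comap, reesChartBase_apply_eq_mul_chartGen c 2 j]
    exact Ideal.mul_mem_right _ _ (reesChartBase_self_mem_chartStageIdeal c 2 _ _)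

end PointPrime

/-! ## §2 Climbing -/

section Climb

variable {S : Type u} [CommRing S] [IsRegularLocalRing S] {I : Ideal S}

namespace LineState

/-- **The END applies at exponent `b = 0`, companion form.** [cite: Kollar2007, (3.111) Step 3] [cite: StacksProject, Tag 080A] -/
theorem companion_of_zero {X : Scheme.{u}} {g : X ⟶ Spec (.of S)} {M 𝓗 E P₁ P₂ : X.IdealSheafData}
    {A B : List (X.IdealSheafData × ℕ)} {a : ℕ} (h : LineState I X g M 𝓗 E P₁ P₂ A B a 0) (hI : I ≠ ⊥)
    (hIm : ((affineBlowup.idealSheaf I).support : Set (Spec (.of S))) ⊆ {IsLocalRing.closedPoint S}) :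
    ∃ (Q : Ideal S) (m : ℕ), IsLocalRing.maximalIdeal S ^ m ≤ Q ∧
      ∃ (B' : Scheme.{u}) (b : B' ⟶ Spec (.of S)),
        IsBlowup b (affineBlowup.idealSheaf (I * Q)) ∧ Scheme.IsRegular B' := by
  haveI := h.isNoetherian
  have hK : 𝓗 * monomialIdeal (A ++ [(E, a)]) ⊔ monomialIdeal (B ++ [(E, 0)]) =
      monomialIdeal ((𝓗, 1) :: (A ++ [(E, a)])) ⊔ monomialIdeal ((𝓗, 0) :: (B ++ [(E, 0)])) := by
    rw [monomialIdeal_cons, monomialIdeal_cons, pow_one, pow_zero, Scheme.IdealSheafData.one_eq_top,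
      Scheme.IdealSheafData.top_mul]
  have hfmt := h.format
  rw [hK] at hfmt
  have hover : ∀ x : X, x ∈ (monomialIdeal ((𝓗, 1) :: (A ++ [(E, a)])) ⊔ monomialIdeal ((𝓗, 0) :: (B ++ [(E, 0)]))).support →
      g x = IsLocalRing.closedPoint S := by
    intro x hx
    have hxI : x ∈ ((affineBlowup.idealSheaf I).comap g).support := by
      rw [hfmt, Scheme.IdealSheafData.support_mul]
      exact Or.inr hx
    rw [Scheme.IdealSheafData.support_comap] at hxI
    exact hIm hxI
  refine coneEndCompanion hI h.isRegular h.exists_isBlowup h.isLocallyPrincipal _ _ ?_ ?_ hover hfmt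
  · show 𝓗 :: boundaryOf (A ++ [(E, a)]) = 𝓗 :: boundaryOf (B ++ [(E, 0)])
    rw [boundaryOf_append, boundaryOf_append, h.boundaryOf_eq]
    rfl
  · intro x hx
    have hxZ : ¬ (x ∈ P₁.support ∧ x ∈ P₂.support ∧ x ∈ E.support) := by
      rintro ⟨h1, h2, h3⟩
      rw [← hK] at hx
      have hB : stalkIdeal (monomialIdeal (B ++ [(E, 0)])) x = ⊤ := by
        rw [stalkIdeal_monomialIdeal, List.map_append, List.prod_append, List.map_singleton, List.prod_singleton,
          pow_zero, mul_one, ← Ideal.one_eq_top]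
        refine List.prod_eq_one fun J hJ => ?_
        obtain ⟨p, hp, rfl⟩ := List.mem_map.mp hJ
        have hD : x ∉ p.1.support := h.not_mem_support p.1 (h.boundaryOf_eq ▸ fst_mem_boundaryOf hp) x h1 h2 h3
        rw [stalkIdeal_eq_top_of_not_mem_support hD, Ideal.top_pow, Ideal.one_eq_top]
      rw [mem_support_iff_stalkIdeal_ne_top, stalkIdeal_sup, hB] at hx
      exact hx (sup_top_eq _)
    have := h.snc x (hover x hx) hxZ
    show DepthSNC.SNCWithAt (𝓗 :: boundaryOf (A ++ [(E, a)])) ⊤ x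
    rwa [boundaryOf_append]

/-- **THE LINE LADDER (companion form).**  Every state gives `I` an `𝔪`-primary companion with a regular blowing up: strong
induction on the exponent `b` — at `b = 0` the END; otherwise blow up the bad line (`blowup.π (P₁ ⊔ P₂ ⊔ E)`) with `step`
(THE LINE FIBRE THEOREM inside), and `b - min (a+2) b < b`. [cite: Kollar2007, 3.61 and (3.111) Step 3] [cite: StacksProject, Tag 080A] -/
theorem companion (hI : I ≠ ⊥) (hIm : ((affineBlowup.idealSheaf I).support : Set (Spec (.of S))) ⊆ {IsLocalRing.closedPoint S})
    (b : ℕ) :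
    ∀ {X : Scheme.{u}} {g : X ⟶ Spec (.of S)} {M 𝓗 E P₁ P₂ : X.IdealSheafData} {A B : List (X.IdealSheafData × ℕ)}
      {a : ℕ}, LineState I X g M 𝓗 E P₁ P₂ A B a b →
      ∃ (Q : Ideal S) (m : ℕ), IsLocalRing.maximalIdeal S ^ m ≤ Q ∧
        ∃ (B' : Scheme.{u}) (b : B' ⟶ Spec (.of S)),
          IsBlowup b (affineBlowup.idealSheaf (I * Q)) ∧ Scheme.IsRegular B' := by
  induction b using Nat.strong_induction_on with
  | _ b ih =>
    intro X g M 𝓗 E P₁ P₂ A B a h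
    rcases Nat.eq_zero_or_pos b with rfl | hb
    · exact h.companion_of_zero hI hIm
    · have hσ := blowup.isBlowup (P₁ ⊔ P₂ ⊔ E)
      have h' := h.step hσ
      have hlt : b - min (a + 2) b < b := by omega
      exact ih _ hlt h'

/-! ## §3 The foot of the ladder: the first blowing up of `Spec S` -/

/-- **THE FOOT OF THE LINE LADDER.**  For `S` regular local with a regular system of parameters `x₀, …, x₃` (spanning `𝔪`,
`μ(𝔪) = 4`), `q = x₀x₀ + b x₀x₁ + a x₁x₁` with `b² − 4a ∈ S×` and `I = (q) + 𝔪^{ℓ+2}`: the blowing up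
`σ₁ : X₁ = Bl_𝔪 Spec S → Spec S` carries a line-ladder state with exponents `(0, ℓ)` — `I𝒪_{X₁} = 𝓘_{E₁}² · (𝓗₁ ⊔ 𝓘_{E₁}^ℓ)`,
`𝓗₁ = σ₁ᶜ((q)~, 2)`, planes `σ₁ᶜ((x₀)~, 1)`, `σ₁ᶜ((x₁)~, 1)`; line data and simple normal crossings from THE POINT FIBRE THEOREM
applied to `Spec S` at its closed point (regular system `x` of `𝒪_{Spec S, 𝔪}`); the bad line contains the point `(φ x₂, e₀, e₁, e₃)`
of the chart `D₊(x₂)`. [cite: Kollar2007, 3.61] [cite: Hartshorne1977, II Prop. 5.1 (b)] [cite: StacksProject, Tag 0BIQ] -/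
theorem initial (x : Fin 4 → S) (hx : Ideal.span (Set.range x) = maximalIdeal S) (hd : (maximalIdeal S).spanFinrank = 4)
    (a b : S) (hD : IsUnit (b ^ 2 - 4 * a)) (ℓ : ℕ) :
    LineState (Ideal.span {x 0 * x 0 + b * (x 0 * x 1) + a * (x 1 * x 1)} ⊔ maximalIdeal S ^ (ℓ + 2))
      (blowup (affineBlowup.idealSheaf (maximalIdeal S))) (blowup.π (affineBlowup.idealSheaf (maximalIdeal S)))
      ((affineBlowup.idealSheaf (maximalIdeal S)).comap (blowup.π (affineBlowup.idealSheaf (maximalIdeal S))) ^ 2)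
      (controlledTransform (blowup.π (affineBlowup.idealSheaf (maximalIdeal S))) (affineBlowup.idealSheaf (maximalIdeal S))
        (affineBlowup.idealSheaf (Ideal.span {x 0 * x 0 + b * (x 0 * x 1) + a * (x 1 * x 1)})) 2)
      ((affineBlowup.idealSheaf (maximalIdeal S)).comap (blowup.π (affineBlowup.idealSheaf (maximalIdeal S))))
      (controlledTransform (blowup.π (affineBlowup.idealSheaf (maximalIdeal S))) (affineBlowup.idealSheaf (maximalIdeal S))
        (affineBlowup.idealSheaf (Ideal.span {x 0})) 1)
      (controlledTransform (blowup.π (affineBlowup.idealSheaf (maximalIdeal S))) (affineBlowup.idealSheaf (maximalIdeal S))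
        (affineBlowup.idealSheaf (Ideal.span {x 1})) 1)
      [] [] 0 ℓ := by
  classical
  set q : S := x 0 * x 0 + b * (x 0 * x 1) + a * (x 1 * x 1) with hqdef
  set J₀ : (Spec (.of S)).IdealSheafData := affineBlowup.idealSheaf (maximalIdeal S) with hJ₀
  set σ := blowup.π J₀ with hσdef
  have hσ : IsBlowup σ J₀ := blowup.isBlowup J₀
  set Hq : (Spec (.of S)).IdealSheafData := affineBlowup.idealSheaf (Ideal.span {q}) with hHq
  set P₁₀ : (Spec (.of S)).IdealSheafData := affineBlowup.idealSheaf (Ideal.span {x 0}) with hP₁₀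
  set P₂₀ : (Spec (.of S)).IdealSheafData := affineBlowup.idealSheaf (Ideal.span {x 1}) with hP₂₀
  haveI : IsDomain S := isDomain_of_isRegularLocalRing S
  haveI : IsRegularRing S := isRegularRing_of_isRegularLocalRing S
  haveI : IsIntegral (Spec (.of S)) := inferInstanceAs (IsIntegral (Spec (CommRingCat.of S)))
  -- the closed point and its local ring `𝒪_{Spec S, 𝔪} = S_𝔪`
  let z₀ : Spec (.of S) := IsLocalRing.closedPoint S
  letI : Algebra S ((Spec (.of S)).presheaf.stalk z₀) :=
    inferInstanceAs (Algebra S ((Spec.structureSheaf S).presheaf.stalk z₀))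
  haveI : IsLocalization.AtPrime ((Spec (.of S)).presheaf.stalk z₀) (maximalIdeal S) :=
    inferInstanceAs (IsLocalization.AtPrime ((Spec.structureSheaf S).presheaf.stalk z₀) z₀.asIdeal)
  haveI hregA : IsRegularLocalRing ((Spec (.of S)).presheaf.stalk z₀) := Scheme.isRegular_Spec (.of S) z₀
  haveI : IsLocalHom (algebraMap S ((Spec (.of S)).presheaf.stalk z₀)) := ⟨fun a ha => by
    have h := (IsLocalization.AtPrime.isUnit_to_map_iff ((Spec (.of S)).presheaf.stalk z₀) (maximalIdeal S) a).mp ha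
    exact (IsLocalRing.notMem_maximalIdeal).mp h⟩
  have hmaxA : maximalIdeal ((Spec (.of S)).presheaf.stalk z₀) =
      (maximalIdeal S).map (algebraMap S ((Spec (.of S)).presheaf.stalk z₀)) :=
    (IsLocalization.AtPrime.map_eq_maximalIdeal (maximalIdeal S) _).symm
  have hdimS : ringKrullDim S = (4 : ℕ) := by rw [← IsRegularLocalRing.spanFinrank_maximalIdeal, hd]
  have hdimA : ringKrullDim ((Spec (.of S)).presheaf.stalk z₀) = (4 : ℕ) := by
    rw [IsLocalization.AtPrime.ringKrullDim_eq_height (maximalIdeal S) ((Spec (.of S)).presheaf.stalk z₀),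
      IsLocalRing.maximalIdeal_height_eq_ringKrullDim, hdimS]
  have hdA : (maximalIdeal ((Spec (.of S)).presheaf.stalk z₀)).spanFinrank = 4 := by
    have h := IsRegularLocalRing.spanFinrank_maximalIdeal (R := (Spec (.of S)).presheaf.stalk z₀)
    rw [hdimA] at h
    exact_mod_cast h
  -- the regular system `x` read in the stalk
  let c : Fin 4 → (Spec (.of S)).presheaf.stalk z₀ := fun i => algebraMap S _ (x i)
  have hrange : Set.range c = algebraMap S ((Spec (.of S)).presheaf.stalk z₀) '' Set.range x := Set.range_comp _ _
  have hc : Ideal.span (Set.range c) = maximalIdeal ((Spec (.of S)).presheaf.stalk z₀) := by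
    rw [hrange, ← Ideal.map_span, hx, hmaxA]
  have hJ : stalkIdeal J₀ z₀ = maximalIdeal ((Spec (.of S)).presheaf.stalk z₀) := by
    rw [hJ₀, DepthTargets.stalkIdeal_idealSheaf_eq, hmaxA]
    rfl
  -- the data over the stalk
  have hD' : IsUnit (algebraMap S ((Spec (.of S)).presheaf.stalk z₀) b ^ 2 - 4 * algebraMap S ((Spec (.of S)).presheaf.stalk z₀) a) := by
    have h := hD.map (algebraMap S ((Spec (.of S)).presheaf.stalk z₀))
    simpa only [map_sub, map_pow, map_mul, map_ofNat] using h
  have heval : algebraMap S ((Spec (.of S)).presheaf.stalk z₀) q =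
      c 0 * c 0 + algebraMap S _ b * (c 0 * c 1) + algebraMap S _ a * (c 1 * c 1) := by
    simp only [hqdef, map_add, map_mul, c]
  have hH₀ : stalkIdeal Hq z₀ = Ideal.span {c 0 * c 0 + algebraMap S _ b * (c 0 * c 1) + algebraMap S _ a * (c 1 * c 1)} := by
    rw [hHq, DepthTargets.stalkIdeal_idealSheaf_eq, Ideal.map_span, Set.image_singleton]
    exact congrArg (fun t => Ideal.span {t}) heval
  have hP₁' : stalkIdeal P₁₀ z₀ = Ideal.span {c 0} := by
    rw [hP₁₀, DepthTargets.stalkIdeal_idealSheaf_eq, Ideal.map_span, Set.image_singleton]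
    rfl
  have hP₂' : stalkIdeal P₂₀ z₀ = Ideal.span {c 1} := by
    rw [hP₂₀, DepthTargets.stalkIdeal_idealSheaf_eq, Ideal.map_span, Set.image_singleton]
    rfl
  -- THE POINT FIBRE THEOREM on `Spec S`
  have hfib := point_fibre hσ z₀ c hc hdA hJ _ _ hD' Hq P₁₀ P₂₀ hH₀ hP₁' hP₂'
  have h𝔪 : maximalIdeal S ≠ ⊥ := by
    intro h
    rw [h, Submodule.spanFinrank_bot] at hd
    exact absurd hd (by norm_num)
  haveI : IsProper σ := hσ.isProper
  haveI : IsLocallyNoetherian (blowup J₀) := LocallyOfFiniteType.isLocallyNoetherian σ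
  have hsuppJ₀ : ∀ s : Spec (.of S), s ∈ J₀.support → s = IsLocalRing.closedPoint S := fun s hs =>
    support_idealSheaf_subset_closedPoint (Q := maximalIdeal S) (n := 1) (by rw [pow_one]) s hs
  have hz₀J : z₀ ∈ J₀.support := by
    rw [mem_support_iff_stalkIdeal_ne_top, hJ]
    exact (maximalIdeal.isMaximal _).ne_top
  -- `q ∈ 𝔪²` and the transform identity for the host
  have hx𝔪 : ∀ i, x i ∈ maximalIdeal S := fun i => hx ▸ Ideal.subset_span ⟨i, rfl⟩
  have hqmem : q ∈ maximalIdeal S ^ 2 := by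
    rw [hqdef, pow_two]
    exact Ideal.add_mem _ (Ideal.add_mem _ (Ideal.mul_mem_mul (hx𝔪 0) (hx𝔪 0))
      (Ideal.mul_mem_left _ _ (Ideal.mul_mem_mul (hx𝔪 0) (hx𝔪 1)))) (Ideal.mul_mem_left _ _ (Ideal.mul_mem_mul (hx𝔪 1) (hx𝔪 1)))
  have hH : J₀.comap σ ^ 2 * controlledTransform σ J₀ Hq 2 = Hq.comap σ := by
    refine pow_mul_controlledTransform_eq σ J₀ hσ.isEffectiveCartier ?_
    rw [← comap_pow]
    refine Scheme.IdealSheafData.comap_mono σ ?_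
    rw [hJ₀, ← DepthOne.idealSheaf_pow]
    refine idealSheaf_mono ?_
    rw [Ideal.span_singleton_le_iff_mem]
    exact hqmem
  -- the witness point of the bad line, on the chart `D₊(x₂)`
  obtain ⟨qc, hqσ, hqiso, -⟩ := exists_charts_over hσ z₀ c (span_eq_stalkIdeal_centre z₀ c hc hJ)
  let w₀ : PrimeSpectrum (chartRing c 2) :=
    ⟨chartStageIdeal c 2 (⊥ : Ideal _) ({0, 1, 3} : Set (Fin 4)), (isMaximal_pointIdeal c hc hdA).isPrime⟩
  haveI : w₀.asIdeal.IsPrime := w₀.isPrime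
  have hw₀ : w₀.asIdeal.comap (chartBase c 2) = maximalIdeal _ := comap_pointIdeal c hc hdA
  have hz₁ : σ (qc 2 w₀) = z₀ := apply_chart_eq_of_comap (hqσ 2) w₀ hw₀
  obtain ⟨χ, hloc, -, -, -, hP1χ, hP2χ⟩ :=
    point_presentation hσ z₀ c hc hJ _ _ Hq P₁₀ P₂₀ hH₀ hP₁' hP₂' qc hqσ hqiso 2 w₀ _ rfl hz₁
  have hne : ∃ z : blowup J₀, z ∈ (controlledTransform σ J₀ P₁₀ 1).support ∧
      z ∈ (controlledTransform σ J₀ P₂₀ 1).support ∧ z ∈ (J₀.comap σ).support := by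
    refine ⟨qc 2 w₀, mem_support_of_mem χ w₀.asIdeal hloc hP1χ (chartGen_mem_chartStageIdeal c 2 _ (by simp)),
      mem_support_of_mem χ w₀.asIdeal hloc hP2χ (chartGen_mem_chartStageIdeal c 2 _ (by simp)), ?_⟩
    rw [mem_support_comap_iff_apply, hz₁]
    exact hz₀J
  refine
    { isIntegral := hσ.isIntegral (affineBlowup.idealSheaf_ne_bot h𝔪)
      isNoetherian := ?_
      isRegular := ?_
      exists_isBlowup := ⟨J₀, hσ, fun s hs => Set.mem_singleton_iff.mpr (hsuppJ₀ s hs)⟩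
      isLocallyPrincipal := hσ.isEffectiveCartier.isLocallyPrincipal.pow 2
      boundaryOf_eq := rfl
      format := ?_
      nonempty := hne
      base_eq := ?_
      line := ?_
      not_mem_support := fun D hD => by simp [boundaryOf] at hD
      snc := ?_ }
  · haveI : CompactSpace (blowup J₀) := QuasiCompact.compactSpace_of_compactSpace σ
    exact {}
  · refine IsBlowup.isRegular_of_isRegular_subscheme (Scheme.isRegular_Spec (.of S)) ?_ hσ
    refine Scheme.isRegular_subscheme_of_forall J₀ fun y hy => ?_
    obtain rfl : y = z₀ := hsuppJ₀ y hy
    rw [hJ]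
    letI := Ideal.Quotient.field (maximalIdeal ((Spec (.of S)).presheaf.stalk z₀))
    infer_instance
  · -- THE FORMAT `I𝒪_{X₁} = 𝓘_{E₁}² · (𝓗₁ ⊔ 𝓘_{E₁}^ℓ)`
    rw [DepthTargets.idealSheaf_sup_eq, DepthOne.idealSheaf_pow, Scheme.IdealSheafData.comap_sup, comap_pow, ← hH,
      List.nil_append, List.nil_append, monomialIdeal_singleton, monomialIdeal_singleton, pow_zero,
      Scheme.IdealSheafData.one_eq_top, Scheme.IdealSheafData.mul_top, ← Scheme.IdealSheafData.add_eq_sup,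
      ← Scheme.IdealSheafData.add_eq_sup]
    ring
  · intro z _ _ h3
    rw [mem_support_comap_iff_apply] at h3
    exact hsuppJ₀ _ h3
  · intro z h1 h2 h3
    rw [mem_support_comap_iff_apply] at h3
    have hz : σ z = z₀ := hsuppJ₀ _ h3
    exact (hfib z hz).1 h1 h2
  · intro x₁ hx₁ hnot
    have hx₁' : σ x₁ = z₀ := hx₁
    have hE₁ : x₁ ∈ (J₀.comap σ).support := by rw [mem_support_comap_iff_apply, hx₁']; exact hz₀J
    have hnl : ¬ (x₁ ∈ (controlledTransform σ J₀ P₁₀ 1).support ∧ x₁ ∈ (controlledTransform σ J₀ P₂₀ 1).support) :=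
      fun hh => hnot ⟨hh.1, hh.2, hE₁⟩
    refine ((hfib x₁ hx₁').2 hnl).anti fun D hD _ => ?_
    simp only [boundaryOf, List.map_nil, List.nil_append, List.mem_cons, List.not_mem_nil, or_false] at hD
    rcases hD with rfl | rfl
    · exact List.mem_cons_self
    · exact List.mem_cons_of_mem _ List.mem_cons_self

end LineState

end Climb

end ConeDepth

end Summit.ResolutionOfSingularities.ResolutionOfSingularities.Theorems

end
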